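import Summits.QuantumFields.BalabanUV.Beta.GAN24.ExitChargeSourcePairing
import Summits.QuantumFields.BalabanUV.Beta.GAN24.PairFormContourClimb
import Summits.QuantumFields.BalabanUV.Beta.GAN24.TransversalZeroMode

/-!
# `BalabanUV.Beta.GAN24.EdgePotentialContourClimb` — binder row G-an2-4 ∕ (CONV-C), the (S) row of RULING R-gan24p1-g27-1 PART B (viii), road-P2's (W-γ) CHARGE TOWER:
# **THE EDGE POTENTIAL CLIMBS — `𝒬_{Lc} m̃^{Lc·P}_{αβ} = Lc^{d+1}·m̃^{P}_{αβ} + (a constant `α`-form) + (a multiple of the period-`P` exit `β`-form)`, HENCE ITS VALUE-HESSIAN IMAGE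
# CLIMBS EXACTLY: `wΦ-image(𝒬_{Lc} m̃^{Lc·P}) = Lc^{d+1}·wΦ-image(m̃^{P})`** — the lemma behind the EXPLICIT potential of the charge tower (leaf-06 g48 Q-leaf06-g48-1 (i); ENGINE E29 (c):
# at jb = 1 the exit⊗exit charge function of `S_1` is `A_1·Δ_1 m̃^{Lc}_{αβ}`) (road-P2 chair `b2b-balaban-gan24-p2`, gen 43, INTENT 3 part 1)

NOT IN PRINT; OUR BOOKKEEPING ([folklore] box ∕ contour arithmetic over leaf-06 g46 `EdgePlaquettePotential.edgePotential_apply` (the edge potential in closed form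
`m̃^L_{ab} l x = [l = a]·L⁻²·(x_b % L) − [l = b]·L⁻¹·𝟙[x_b % L = L−1]·(x_a % L)`), leaf-02 g57 PART C `PairFormContourClimb` (`ediv_block`, `contourPt_apply`), MY INTENT 2
`ExitChargeSourcePairing` (`tsum_sum_wΦ_mul_exitForm_eq_zero`, `tsum_wΦ_sub_eq_zero`, `summable_sum_wΦ_sub_mul`), MY g41 `ChargeTowerRegauge.tsum_sum_wΦ_mul_dz_eq_zero`, an2's
`AffineAveraging.contourSum_dz`; 0 `def`, 0 cited fact, 0 `def … : Prop`, 0 sorry).  HONEST FRAMING (cell contract, verbatim): «discharging `BetaPertH` makes Bałaban's UV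
stability UNCONDITIONAL — a real constructive-QFT result; it is NOT the continuum limit and NOT the Clay problem.»  HONEST DEPENDENCY (verbatim): «continuum YM on T⁴ ⇐ BetaPertH ∧
nine spine estimates (0/9 proved); BetaPertH ⇐ (D1) ∧ (D4) ∧ CAP+tail; G-an2-4 gates asym, D1 and NE2/3/4.»

WHY.  MY g42 `ChargeTowerInduction.tower` gives the exit⊗exit charge function of `S_{j+1}` as `Δ_{j+1} m` for SOME bounded comb-gauged `Lc`-periodic `m`, built by climbing:
`m_{k+1} = A_k·Π^ρ(𝒬_{Lc} m_k)`, `m_0 = Π^ρ((−cE∕2)·m̃^{Lc^{j+2}}_{αβ})` (`tower_zero ∕ tower_succ`).  leaf-06's (M3) mechanism at level 0 (FILES D∕E: the (γ) defect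
`⟨𝒬(σ_{1_B}⊙n_m), colM⟩` vanishes) is proved for the EDGE POTENTIAL `m̃^{Lc}` explicitly; to run it one level up the tower's potential must be KNOWN to be a multiple of `Π^ρ m̃^{Lc}`
(ENGINE E29 (c) says it is).  The one missing identity is how `𝒬_{Lc}` acts on `m̃^{Lc·P}`: this file.  Exact rational check before typing: `gen43/eng/qclimb_check.py`
(D = 2, 3; (Lc, P) ∈ {(3,3),(2,2),(3,1),(2,4),(3,2)}: `𝒬_{Lc} m̃^{Lc·P} − Lc^D·m̃^P` closed, = mean + `d`(bounded `P`-periodic)).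
WHAT (generic `d`, `α ≠ β`, `1 ≤ Lc`, `1 ≤ P`; the edge potential in leaf-06's CLOSED (ite) FORM at scale `L`, written inline — `edgePotential_apply` converts g46's `dz`-form).
* §1 `emod_block` (`(Lc·q + t) % (Lc·P) = Lc·(q % P) + t` for `0 ≤ t < Lc`), `sum_range_exitInd_contour` (along a straight `β`-contour of `Lc` bonds from offset `t < Lc` exactly ONE bond
  is a period-`Lc·P` exit bond, and only when the coarse point is a period-`P` exit point: `Σ_{s<Lc} 𝟙[(Lc·q + t + s) % (Lc·P) = Lc·P − 1] = 𝟙[q % P = P − 1]`), `card_box`.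
* §2 **`contourSum_edgePotential`**: `𝒬_{Lc} m̃^{Lc·P} κ w = Lc^{d+1}·m̃^{P} κ w + [κ = α]·c₁ − [κ = β]·c₂·𝟙[w_β % P = P−1]`, `c₁ = Lc·(Lc·P)⁻²·Σ_{v∈box} v_β`, `c₂ = (Lc·P)⁻¹·Σ_{v∈box} v_α`.
* §3 **`tsum_sum_wΦ_mul_contourSum_edgePotential`**: for every blocking `M`, `Σ'_v Σ_l wΦ_M κ l (u − v)·(𝒬_{Lc} m̃^{Lc·P}) l v = Lc^{d+1}·Σ'_v Σ_l wΦ_M κ l (u − v)·m̃^{P} l v` — the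
  constant `α`-form has zero image (zero `mm` mass, INTENT 2 `tsum_wΦ_sub_eq_zero`), the exit `β`-form has zero image (INTENT 2 `tsum_sum_wΦ_mul_exitForm_eq_zero`).
* §4 **`tsum_sum_wΦ_mul_contourSum_axProjAt`**: for every bounded `m` and any root, `wΦ-image(𝒬_{Lc}(Π^ρ m)) = wΦ-image(𝒬_{Lc} m)` — `Π^ρ m = m − dτ` with `τ` bounded
  (`abs_treeGaugeAt_le`), `𝒬_{Lc}(dτ) = d(blockSum τ)` (`contourSum_dz`), and the image is blind to bounded gradients (`tsum_sum_wΦ_mul_dz_eq_zero`).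
READING.  With §3∕§4, `ChargeTowerClimb` §7 and `tower_zero`'s explicit first rung, the tower's potential at every level is `c_{j+1}·Π^ρ m̃^{Lc·M}_{αβ}` INSIDE THE IMAGE
(part 2: `ChargeTowerExplicitPotential`).  Asserts NO value of any resolvent column; NOTHING of (W-γ) ∕ (INV) ∕ (S) ∕ (Q-R) ∕ «T2Shape» ∕ (hW, hWall) discharged; NEVER
«G-an2-4 closed» as (CONV-C); NOT D1, NOT `BetaPertH`, NOT continuum, NOT Clay.  2026-08-22; no existing file touched.
-/

noncomputable section

open Finset
open scoped BigOperators
open Literature.MathematicalPhysics.QuantumFieldTheory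
open Literature.MathematicalPhysics.QuantumFieldTheory.Balaban1983to89
open Literature.MathematicalPhysics.QuantumFieldTheory.Balaban1983to89.Beta
open ExpKernelCalculus (Site)
open AffineAveraging (Form0 Form1 box toSite unitVec unitVec_apply dz contourSum blockSum contourSum_dz)
open AveragingContoursRooted (treeGaugeAt)
open RootedComb (axProjAt axProjAt_apply)
open KernelSpecInstance (wΦ)
open OneStepResolventKernel (Fib)
open Summit.QuantumFields.BalabanUV.Beta.GAN24.PairFormContourClimb (ediv_block contourPt_apply)
open Summit.QuantumFields.BalabanUV.Beta.GAN24.TransversalZeroMode (card_box_succ)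
open Summit.QuantumFields.BalabanUV.Beta.GAN24.CoDressedColumnPairing (abs_treeGaugeAt_le)
open Summit.QuantumFields.BalabanUV.Beta.GAN24.ChargeTowerRegauge (tsum_sum_wΦ_mul_dz_eq_zero)
open Summit.QuantumFields.BalabanUV.Beta.GAN24.ExitChargeSourcePairing (summable_wΦ_sub_mul summable_sum_wΦ_sub_mul tsum_wΦ_sub_eq_zero tsum_sum_wΦ_mul_exitForm_eq_zero)

namespace Summit.QuantumFields.BalabanUV.Beta.GAN24.EdgePotentialContourClimb

variable {d : ℕ}

/-! ## §1 Box and contour arithmetic -/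

/-- [folklore] **RESIDUES INSIDE A SUPER-BLOCK**: `(Lc·q + t) % (Lc·P) = Lc·(q % P) + t` for `0 ≤ t < Lc` (`1 ≤ Lc`, `1 ≤ P`). -/
theorem emod_block {Lc P : ℕ} (hP : 1 ≤ P) (q t : ℤ) (h0 : 0 ≤ t) (h1 : t < (Lc : ℤ)) :
    ((Lc : ℤ) * q + t) % ((Lc * P : ℕ) : ℤ) = (Lc : ℤ) * (q % (P : ℤ)) + t := by
  have hP0 : (0 : ℤ) < P := by exact_mod_cast hP
  have hL0 : (0 : ℤ) ≤ Lc := by exact_mod_cast (Nat.zero_le Lc)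
  have hq := Int.emod_add_mul_ediv q (P : ℤ)
  have hr0 : 0 ≤ q % (P : ℤ) := Int.emod_nonneg q hP0.ne'
  have hr1 : q % (P : ℤ) < P := Int.emod_lt_of_pos q hP0
  have e : (Lc : ℤ) * q + t = ((Lc : ℤ) * (q % (P : ℤ)) + t) + ((Lc * P : ℕ) : ℤ) * (q / (P : ℤ)) := by
    push_cast
    linear_combination (-(Lc : ℤ)) * hq
  rw [e, Int.add_mul_emod_self_left]
  refine Int.emod_eq_of_lt (by nlinarith) ?_
  have h2 : (Lc : ℤ) * (q % (P : ℤ)) ≤ (Lc : ℤ) * ((P : ℤ) - 1) := mul_le_mul_of_nonneg_left (by omega) hL0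
  push_cast
  nlinarith

/-- [folklore] **ONE EXIT BOND PER STRAIGHT CONTOUR, AND ONLY AT A COARSE EXIT POINT**: along the `Lc` bonds `Lc·q + t + s`, `s < Lc`, from an offset `t < Lc`, the period-`Lc·P` exit
indicator fires exactly once — at `s = Lc − 1 − t` — and only when `q % P = P − 1`:  `Σ_{s<Lc} 𝟙[(Lc·q + t + s) % (Lc·P) = Lc·P − 1] = 𝟙[q % P = P − 1]`. -/
theorem sum_range_exitInd_contour {Lc P : ℕ} (hLc : 1 ≤ Lc) (hP : 1 ≤ P) (q : ℤ) {t : ℕ} (ht : t < Lc) :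
    ∑ s ∈ Finset.range Lc, (if ((Lc : ℤ) * q + (t : ℤ) + (s : ℤ)) % ((Lc * P : ℕ) : ℤ) = ((Lc * P : ℕ) : ℤ) - 1 then (1 : ℝ) else 0)
      = if q % (P : ℤ) = (P : ℤ) - 1 then (1 : ℝ) else 0 := by
  have hP0 : (0 : ℤ) < P := by exact_mod_cast hP
  have hL0 : (0 : ℤ) ≤ Lc := by exact_mod_cast (Nat.zero_le Lc)
  rw [Finset.sum_eq_single_of_mem (Lc - 1 - t) (Finset.mem_range.2 (by omega))]
  · -- the exit bond
    have hs : (((Lc - 1 - t : ℕ) : ℤ)) = (Lc : ℤ) - 1 - (t : ℤ) := by omega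
    rw [hs, show (Lc : ℤ) * q + (t : ℤ) + ((Lc : ℤ) - 1 - (t : ℤ)) = (Lc : ℤ) * q + ((Lc : ℤ) - 1) by ring,
      emod_block hP q _ (by omega) (by omega)]
    have hr0 : 0 ≤ q % (P : ℤ) := Int.emod_nonneg q hP0.ne'
    have hr1 : q % (P : ℤ) < P := Int.emod_lt_of_pos q hP0
    by_cases hq : q % (P : ℤ) = (P : ℤ) - 1
    · rw [if_pos hq, hq, if_pos]
      push_cast; ring
    · rw [if_neg hq, if_neg]
      intro h
      apply hq
      push_cast at h
      have h1 : (Lc : ℤ) * (q % (P : ℤ)) = (Lc : ℤ) * ((P : ℤ) - 1) := by linarith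
      have hL1 : (0 : ℤ) < Lc := by exact_mod_cast hLc
      exact mul_left_cancel₀ hL1.ne' h1
  · -- every other bond of the contour
    intro s hs hne
    have hsL : s < Lc := Finset.mem_range.1 hs
    rw [if_neg]
    intro h
    by_cases hlt : t + s < Lc
    · rw [show (Lc : ℤ) * q + (t : ℤ) + (s : ℤ) = (Lc : ℤ) * q + ((t : ℤ) + (s : ℤ)) by ring,
        emod_block hP q _ (by omega) (by omega)] at h
      have hr1 : q % (P : ℤ) < P := Int.emod_lt_of_pos q hP0
      have h2 : (Lc : ℤ) * (q % (P : ℤ)) ≤ (Lc : ℤ) * ((P : ℤ) - 1) := mul_le_mul_of_nonneg_left (by omega) hL0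
      push_cast at h
      have : (t : ℤ) + (s : ℤ) = (Lc : ℤ) - 1 := by nlinarith
      omega
    · rw [show (Lc : ℤ) * q + (t : ℤ) + (s : ℤ) = (Lc : ℤ) * (q + 1) + ((t : ℤ) + (s : ℤ) - (Lc : ℤ)) by ring,
        emod_block hP (q + 1) _ (by omega) (by omega)] at h
      have hr1 : (q + 1) % (P : ℤ) < P := Int.emod_lt_of_pos (q + 1) hP0
      have h2 : (Lc : ℤ) * ((q + 1) % (P : ℤ)) ≤ (Lc : ℤ) * ((P : ℤ) - 1) := mul_le_mul_of_nonneg_left (by omega) hL0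
      push_cast at h
      nlinarith

/-! ## §2 The straight block contour sum of the edge potential -/

/-- NOT IN PRINT; OUR BOOKKEEPING.  **THE EDGE POTENTIAL CLIMBS** (`α ≠ β`, `1 ≤ Lc`, `1 ≤ P`, every direction `κ` and coarse point `w`): with leaf-06's edge potential at scale `L`
in closed form `m̃^L l x = [l = α]·L⁻²·(x_β % L) − [l = β]·L⁻¹·𝟙[x_β % L = L−1]·(x_α % L)`,
`𝒬_{Lc} m̃^{Lc·P} κ w = Lc^{d+1}·m̃^{P} κ w + [κ = α]·(Lc·(Lc·P)⁻²·Σ_{v∈box} v_β) − [κ = β]·((Lc·P)⁻¹·Σ_{v∈box} v_α)·𝟙[w_β % P = P−1]`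
— `α`-contours: the residue `(Lc·w_β + v_β) % (Lc·P) = Lc·(w_β % P) + v_β` is constant along the contour (§1); `β`-contours: one exit bond each, at a coarse exit point only (§1). -/
theorem contourSum_edgePotential {Lc P : ℕ} (hLc : 1 ≤ Lc) (hP : 1 ≤ P) {α β : Fin (d + 1)} (hαβ : α ≠ β) (κ : Fin (d + 1)) (w : Site (d + 1)) :
    contourSum Lc (fun l x => (if l = α then ((((Lc * P : ℕ) : ℝ)) ^ 2)⁻¹ * (((x β % ((Lc * P : ℕ) : ℤ) : ℤ)) : ℝ) else 0)
        - (if l = β then (((Lc * P : ℕ) : ℝ))⁻¹ * (if x β % ((Lc * P : ℕ) : ℤ) = ((Lc * P : ℕ) : ℤ) - 1 then (1 : ℝ) else 0) * (((x α % ((Lc * P : ℕ) : ℤ) : ℤ)) : ℝ) else 0)) κ w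
      = (Lc : ℝ) ^ (d + 1) * ((if κ = α then (((P : ℝ)) ^ 2)⁻¹ * (((w β % (P : ℤ) : ℤ)) : ℝ) else 0)
          - (if κ = β then ((P : ℝ))⁻¹ * (if w β % (P : ℤ) = (P : ℤ) - 1 then (1 : ℝ) else 0) * (((w α % (P : ℤ) : ℤ)) : ℝ) else 0))
        + (if κ = α then (Lc : ℝ) * ((((Lc * P : ℕ) : ℝ)) ^ 2)⁻¹ * ∑ v ∈ box (d + 1) Lc, ((v β : ℕ) : ℝ) else 0)
        - (if κ = β then (((Lc * P : ℕ) : ℝ))⁻¹ * (∑ v ∈ box (d + 1) Lc, ((v α : ℕ) : ℝ)) * (if w β % (P : ℤ) = (P : ℤ) - 1 then (1 : ℝ) else 0) else 0) := by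
  classical
  have hLP : ((Lc * P : ℕ) : ℝ) = (Lc : ℝ) * (P : ℝ) := by push_cast; ring
  have hL0 : (Lc : ℝ) ≠ 0 := by exact_mod_cast (show Lc ≠ 0 by omega)
  have hP0 : (P : ℝ) ≠ 0 := by exact_mod_cast (show P ≠ 0 by omega)
  have hvlt : ∀ v ∈ box (d + 1) Lc, ∀ c : Fin (d + 1), v c < Lc := fun v hv c => Finset.mem_range.1 (Fintype.mem_piFinset.1 hv c)
  simp only [AffineAveraging.contourSum, contourPt_apply]
  by_cases hκα : κ = α
  · have hκβ : κ ≠ β := fun h => hαβ (hκα.symm.trans h)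
    have hβκ : ¬ (β = κ) := fun h => hκβ h.symm
    simp only [if_pos hκα, if_neg hκβ, if_neg hβκ, add_zero, sub_zero]
    -- the residue is constant along the contour
    have e : ∀ v ∈ box (d + 1) Lc, (∑ s ∈ Finset.range Lc, ((((Lc * P : ℕ) : ℝ)) ^ 2)⁻¹ * (((((Lc : ℤ) * w β + (v β : ℤ)) % ((Lc * P : ℕ) : ℤ) : ℤ)) : ℝ))
        = (Lc : ℝ) * ((((Lc * P : ℕ) : ℝ)) ^ 2)⁻¹ * ((Lc : ℝ) * (((w β % (P : ℤ) : ℤ)) : ℝ)) + (Lc : ℝ) * ((((Lc * P : ℕ) : ℝ)) ^ 2)⁻¹ * ((v β : ℕ) : ℝ) := by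
      intro v hv
      rw [emod_block hP (w β) (v β) (by positivity) (by exact_mod_cast hvlt v hv β), Finset.sum_const, Finset.card_range, nsmul_eq_mul]
      push_cast; ring
    rw [Finset.sum_congr rfl e, Finset.sum_add_distrib, Finset.sum_const, card_box_succ, nsmul_eq_mul, ← Finset.mul_sum, hLP]
    push_cast
    field_simp
  · by_cases hκβ : κ = β
    · have hακ : ¬ (α = κ) := fun h => hκα h.symm
      simp only [if_neg hκα, if_pos hκβ, if_neg hακ, if_pos hκβ.symm, add_zero, zero_sub]
      -- one exit bond per contour, at a coarse exit point only
      have e : ∀ v ∈ box (d + 1) Lc, (∑ s ∈ Finset.range Lc, -((((Lc * P : ℕ) : ℝ))⁻¹ * (if ((Lc : ℤ) * w β + ((v β : ℕ) : ℤ) + (s : ℤ)) % ((Lc * P : ℕ) : ℤ) = ((Lc * P : ℕ) : ℤ) - 1 then (1 : ℝ) else 0) * (((((Lc : ℤ) * w α + ((v α : ℕ) : ℤ)) % ((Lc * P : ℕ) : ℤ) : ℤ)) : ℝ)))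
          = -((((Lc * P : ℕ) : ℝ))⁻¹ * (if w β % (P : ℤ) = (P : ℤ) - 1 then (1 : ℝ) else 0) * ((Lc : ℝ) * (((w α % (P : ℤ) : ℤ)) : ℝ)))
            + -((((Lc * P : ℕ) : ℝ))⁻¹ * (if w β % (P : ℤ) = (P : ℤ) - 1 then (1 : ℝ) else 0) * ((v α : ℕ) : ℝ)) := by
        intro v hv
        rw [emod_block hP (w α) (v α) (by positivity) (by exact_mod_cast hvlt v hv α)]
        have h1 := sum_range_exitInd_contour (P := P) hLc hP (w β) (hvlt v hv β)
        have e2 : ∀ s ∈ Finset.range Lc, -((((Lc * P : ℕ) : ℝ))⁻¹ * (if ((Lc : ℤ) * w β + ((v β : ℕ) : ℤ) + (s : ℤ)) % ((Lc * P : ℕ) : ℤ) = ((Lc * P : ℕ) : ℤ) - 1 then (1 : ℝ) else 0) * ((((Lc : ℤ) * (w α % (P : ℤ)) + ((v α : ℕ) : ℤ) : ℤ)) : ℝ)) = (-((((Lc * P : ℕ) : ℝ))⁻¹ * ((((Lc : ℤ) * (w α % (P : ℤ)) + ((v α : ℕ) : ℤ) : ℤ)) : ℝ))) * (if ((Lc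 : ℤ) * w β + ((v β : ℕ) : ℤ) + (s : ℤ)) % ((Lc * P : ℕ) : ℤ) = ((Lc * P : ℕ) : ℤ) - 1 then (1 : ℝ) else 0) := fun s _ => by ring
        rw [Finset.sum_congr rfl e2, ← Finset.mul_sum, h1]
        push_cast; ring
      rw [Finset.sum_congr rfl e, Finset.sum_add_distrib, Finset.sum_const, card_box_succ, nsmul_eq_mul]
      have e3 : ∑ v ∈ box (d + 1) Lc, -((((Lc * P : ℕ) : ℝ))⁻¹ * (if w β % (P : ℤ) = (P : ℤ) - 1 then (1 : ℝ) else 0) * ((v α : ℕ) : ℝ))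
          = -((((Lc * P : ℕ) : ℝ))⁻¹ * (∑ v ∈ box (d + 1) Lc, ((v α : ℕ) : ℝ)) * (if w β % (P : ℤ) = (P : ℤ) - 1 then (1 : ℝ) else 0)) := by
        rw [Finset.mul_sum, Finset.sum_mul, ← Finset.sum_neg_distrib]
        exact Finset.sum_congr rfl fun v _ => by ring
      rw [e3, hLP]
      push_cast
      field_simp
      ring
    · have hακ : ¬ (α = κ) := fun h => hκα h.symm
      have hβκ : ¬ (β = κ) := fun h => hκβ h.symm
      simp only [if_neg hκα, if_neg hκβ, sub_zero, Finset.sum_const_zero, mul_zero, add_zero]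

/-! ## §3 The value-Hessian image of the climbed edge potential -/

/-- NOT IN PRINT; OUR BOOKKEEPING.  **THE VALUE-HESSIAN IMAGE OF THE EDGE POTENTIAL CLIMBS EXACTLY** (`α ≠ β`, `1 ≤ Lc`, `1 ≤ P`, every blocking `M`, every slot `(κ, u)`):
`Σ'_v Σ_l wΦ_M κ l (u − v)·(𝒬_{Lc} m̃^{Lc·P}) l v = Lc^{d+1}·Σ'_v Σ_l wΦ_M κ l (u − v)·m̃^{P} l v` — by §2 the difference is a constant `α`-form (zero image: zero `mm` mass) minus a multiple of
the period-`P` exit `β`-form (zero image: INTENT 2 §1). -/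
theorem tsum_sum_wΦ_mul_contourSum_edgePotential (M : ℕ) [NeZero M] {Lc P : ℕ} (hLc : 1 ≤ Lc) (hP : 1 ≤ P) {α β : Fin (d + 1)} (hαβ : α ≠ β)
    (κ : Fin (d + 1)) (u : Site (d + 1)) :
    ∑' v, ∑ l : Fin (d + 1), wΦ (N := M) κ l (u - v)
        * contourSum Lc (fun l x => (if l = α then ((((Lc * P : ℕ) : ℝ)) ^ 2)⁻¹ * (((x β % ((Lc * P : ℕ) : ℤ) : ℤ)) : ℝ) else 0)
            - (if l = β then (((Lc * P : ℕ) : ℝ))⁻¹ * (if x β % ((Lc * P : ℕ) : ℤ) = ((Lc * P : ℕ) : ℤ) - 1 then (1 : ℝ) else 0) * (((x α % ((Lc * P : ℕ) : ℤ) : ℤ)) : ℝ) else 0)) l v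
      = (Lc : ℝ) ^ (d + 1) * ∑' v, ∑ l : Fin (d + 1), wΦ (N := M) κ l (u - v)
          * ((if l = α then (((P : ℝ)) ^ 2)⁻¹ * (((v β % (P : ℤ) : ℤ)) : ℝ) else 0)
            - (if l = β then ((P : ℝ))⁻¹ * (if v β % (P : ℤ) = (P : ℤ) - 1 then (1 : ℝ) else 0) * (((v α % (P : ℤ) : ℤ)) : ℝ) else 0)) := by
  classical
  have hP0 : (0 : ℤ) < P := by exact_mod_cast hP
  -- abbreviations for the three pieces of §2
  set c₁ : ℝ := (Lc : ℝ) * ((((Lc * P : ℕ) : ℝ)) ^ 2)⁻¹ * ∑ v ∈ box (d + 1) Lc, ((v β : ℕ) : ℝ) with hc₁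
  set c₂ : ℝ := (((Lc * P : ℕ) : ℝ))⁻¹ * ∑ v ∈ box (d + 1) Lc, ((v α : ℕ) : ℝ) with hc₂
  set E : Form1 (d + 1) ℝ := fun l v => (if l = α then (((P : ℝ)) ^ 2)⁻¹ * (((v β % (P : ℤ) : ℤ)) : ℝ) else 0)
    - (if l = β then ((P : ℝ))⁻¹ * (if v β % (P : ℤ) = (P : ℤ) - 1 then (1 : ℝ) else 0) * (((v α % (P : ℤ) : ℤ)) : ℝ) else 0) with hE
  simp only [contourSum_edgePotential hLc hP hαβ]
  -- bounds
  have hres : ∀ (c : Fin (d + 1)) (v : Site (d + 1)), |(((v c % (P : ℤ) : ℤ)) : ℝ)| ≤ (P : ℝ) := fun c v => by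
    have h0 : (0 : ℝ) ≤ ((v c % (P : ℤ) : ℤ) : ℝ) := by exact_mod_cast Int.emod_nonneg _ hP0.ne'
    have h1 : ((v c % (P : ℤ) : ℤ) : ℝ) < (P : ℝ) := by exact_mod_cast Int.emod_lt_of_pos _ hP0
    rw [abs_of_nonneg h0]; exact h1.le
  have hEb : ∀ l v, |E l v| ≤ (((P : ℝ)) ^ 2)⁻¹ * (P : ℝ) + ((P : ℝ))⁻¹ * 1 * (P : ℝ) := by
    intro l v
    have hA : |(if l = α then (((P : ℝ)) ^ 2)⁻¹ * (((v β % (P : ℤ) : ℤ)) : ℝ) else 0)| ≤ (((P : ℝ)) ^ 2)⁻¹ * (P : ℝ) := by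
      by_cases hl : l = α
      · rw [if_pos hl, abs_mul, abs_of_nonneg (by positivity : (0 : ℝ) ≤ (((P : ℝ)) ^ 2)⁻¹)]
        exact mul_le_mul_of_nonneg_left (hres β v) (by positivity)
      · rw [if_neg hl, abs_zero]; positivity
    have hB : |(if l = β then ((P : ℝ))⁻¹ * (if v β % (P : ℤ) = (P : ℤ) - 1 then (1 : ℝ) else 0) * (((v α % (P : ℤ) : ℤ)) : ℝ) else 0)|
        ≤ ((P : ℝ))⁻¹ * 1 * (P : ℝ) := by
      by_cases hl : l = β
      · rw [if_pos hl, abs_mul, abs_mul, abs_of_nonneg (by positivity : (0 : ℝ) ≤ ((P : ℝ))⁻¹)]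
        refine mul_le_mul (mul_le_mul_of_nonneg_left ?_ (by positivity)) (hres α v) (abs_nonneg _) (by positivity)
        split_ifs <;> simp
      · rw [if_neg hl, abs_zero]; positivity
    simp only [hE]
    exact (abs_sub _ _).trans (add_le_add hA hB)
  have hs1 := summable_sum_wΦ_sub_mul M (g := fun l v => (Lc : ℝ) ^ (d + 1) * E l v) (B := |(Lc : ℝ) ^ (d + 1)| * ((((P : ℝ)) ^ 2)⁻¹ * (P : ℝ) + ((P : ℝ))⁻¹ * 1 * (P : ℝ)))
    (fun l v => by rw [abs_mul]; exact mul_le_mul_of_nonneg_left (hEb l v) (abs_nonneg _)) κ u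
  have hs2 := summable_sum_wΦ_sub_mul M (g := fun l _ => if l = α then c₁ else 0) (B := |c₁|) (fun l v => by split_ifs <;> simp) κ u
  have hs3 := summable_sum_wΦ_sub_mul M (g := fun l (v : Site (d + 1)) => if l = β then c₂ * (if v β % (P : ℤ) = (P : ℤ) - 1 then (1 : ℝ) else 0) else 0)
    (B := |c₂|) (fun l v => by split_ifs <;> simp) κ u
  -- split
  have e : ∀ v, (∑ l : Fin (d + 1), wΦ (N := M) κ l (u - v) * ((Lc : ℝ) ^ (d + 1) * E l v + (if l = α then c₁ else 0)
        - (if l = β then c₂ * (if v β % (P : ℤ) = (P : ℤ) - 1 then (1 : ℝ) else 0) else 0)))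
      = ((∑ l : Fin (d + 1), wΦ (N := M) κ l (u - v) * ((Lc : ℝ) ^ (d + 1) * E l v)) + ∑ l : Fin (d + 1), wΦ (N := M) κ l (u - v) * (if l = α then c₁ else 0))
        - ∑ l : Fin (d + 1), wΦ (N := M) κ l (u - v) * (if l = β then c₂ * (if v β % (P : ℤ) = (P : ℤ) - 1 then (1 : ℝ) else 0) else 0) := by
    intro v
    rw [← Finset.sum_add_distrib, ← Finset.sum_sub_distrib]
    exact Finset.sum_congr rfl fun l _ => by ring
  have e0 : (fun v => ∑ l : Fin (d + 1), wΦ (N := M) κ l (u - v) * ((Lc : ℝ) ^ (d + 1) * E l v + (if l = α then c₁ else 0)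
        - (if l = β then c₂ * (if v β % (P : ℤ) = (P : ℤ) - 1 then (1 : ℝ) else 0) else 0)))
      = fun v => ∑ l : Fin (d + 1), wΦ (N := M) κ l (u - v) * ((Lc : ℝ) ^ (d + 1) * ((if l = α then (((P : ℝ)) ^ 2)⁻¹ * (((v β % (P : ℤ) : ℤ)) : ℝ) else 0)
          - (if l = β then ((P : ℝ))⁻¹ * (if v β % (P : ℤ) = (P : ℤ) - 1 then (1 : ℝ) else 0) * (((v α % (P : ℤ) : ℤ)) : ℝ) else 0))
        + (if l = α then (Lc : ℝ) * ((((Lc * P : ℕ) : ℝ)) ^ 2)⁻¹ * ∑ v ∈ box (d + 1) Lc, ((v β : ℕ) : ℝ) else 0)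
        - (if l = β then (((Lc * P : ℕ) : ℝ))⁻¹ * (∑ v ∈ box (d + 1) Lc, ((v α : ℕ) : ℝ)) * (if v β % (P : ℤ) = (P : ℤ) - 1 then (1 : ℝ) else 0) else 0)) := rfl
  rw [← e0, tsum_congr e, (hs1.add hs2).tsum_sub hs3, hs1.tsum_add hs2]
  -- the constant `α`-form: zero image
  have h2 : ∑' v, ∑ l : Fin (d + 1), wΦ (N := M) κ l (u - v) * (if l = α then c₁ else 0) = 0 := by
    have e2 : ∀ v, (∑ l : Fin (d + 1), wΦ (N := M) κ l (u - v) * (if l = α then c₁ else 0)) = wΦ (N := M) κ α (u - v) * c₁ := fun v => by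
      rw [Finset.sum_eq_single α (fun l _ hl => by rw [if_neg hl, mul_zero]) (fun h => (h (Finset.mem_univ α)).elim), if_pos rfl]
    rw [tsum_congr e2, tsum_mul_right, tsum_wΦ_sub_eq_zero, zero_mul]
  -- the exit `β`-form: zero image
  have h3 : ∑' v, ∑ l : Fin (d + 1), wΦ (N := M) κ l (u - v) * (if l = β then c₂ * (if v β % (P : ℤ) = (P : ℤ) - 1 then (1 : ℝ) else 0) else 0) = 0 := by
    have e3 : ∀ v, (∑ l : Fin (d + 1), wΦ (N := M) κ l (u - v) * (if l = β then c₂ * (if v β % (P : ℤ) = (P : ℤ) - 1 then (1 : ℝ) else 0) else 0))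
        = ∑ l : Fin (d + 1), wΦ (N := M) κ l (u - v) * ((if l = β then c₂ else 0) * (if v l % (P : ℤ) = (P : ℤ) - 1 then (1 : ℝ) else 0)) := by
      intro v
      refine Finset.sum_congr rfl fun l _ => ?_
      by_cases hl : l = β
      · subst hl; rw [if_pos rfl, if_pos rfl]
      · rw [if_neg hl, if_neg hl, zero_mul]
    rw [tsum_congr e3]
    exact tsum_sum_wΦ_mul_exitForm_eq_zero M hP (fun l => if l = β then c₂ else 0) κ u
  rw [h2, h3, add_zero, sub_zero]
  -- the main term
  have e4 : ∀ v, (∑ l : Fin (d + 1), wΦ (N := M) κ l (u - v) * ((Lc : ℝ) ^ (d + 1) * E l v)) = (Lc : ℝ) ^ (d + 1) * ∑ l : Fin (d + 1), wΦ (N := M) κ l (u - v) * E l v := by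
    intro v; rw [Finset.mul_sum]; exact Finset.sum_congr rfl fun l _ => by ring
  rw [tsum_congr e4, tsum_mul_left]

/-! ## §4 The image does not see the hard-axial gauge inside the contour sum -/

/-- NOT IN PRINT; OUR BOOKKEEPING.  **THE VALUE-HESSIAN IMAGE OF `𝒬_{Lc}(Π^ρ m)` IS THAT OF `𝒬_{Lc} m`** (any root offset `ρ`, any in-block root bound via `abs_treeGaugeAt_le`, every
blocking `M`, bounded `m`): `Π^ρ m = m − dτ`, `τ = treeGaugeAt ρ m Lc` bounded; `𝒬_{Lc}(dτ) = d(blockSum_{Lc} τ)` (`contourSum_dz`) with `blockSum τ` bounded; the image of a bounded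
gradient vanishes (`tsum_sum_wΦ_mul_dz_eq_zero`). -/
theorem tsum_sum_wΦ_mul_contourSum_axProjAt (M : ℕ) [NeZero M] {Lc : ℕ} (hLc : 1 ≤ Lc) {r : Fin (d + 1) → ℕ} (hr : r ∈ box (d + 1) Lc)
    {m : Form1 (d + 1) ℝ} {B : ℝ} (hmB : ∀ κ u, |m κ u| ≤ B) (κ : Fin (d + 1)) (u : Site (d + 1)) :
    ∑' v, ∑ l : Fin (d + 1), wΦ (N := M) κ l (u - v) * contourSum Lc (axProjAt (toSite r) Lc m) l v
      = ∑' v, ∑ l : Fin (d + 1), wΦ (N := M) κ l (u - v) * contourSum Lc m l v := by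
  classical
  have hB0 : 0 ≤ B := (abs_nonneg _).trans (hmB 0 0)
  -- `Π^ρ m = m − dτ`
  have e0 : axProjAt (toSite r) Lc m = fun l z => m l z - dz (treeGaugeAt (toSite r) m Lc) l z := by
    funext l z; rw [axProjAt_apply]; rfl
  have hτ : ∀ x, |treeGaugeAt (toSite r) m Lc x| ≤ (((d + 1 : ℕ) : ℝ)) * Lc * B := fun x => abs_treeGaugeAt_le hLc hr hmB x
  -- `𝒬(m − dτ) = 𝒬 m − d(blockSum τ)` pointwise
  have e1 : ∀ l v, contourSum Lc (axProjAt (toSite r) Lc m) l v = contourSum Lc m l v - dz (blockSum Lc (treeGaugeAt (toSite r) m Lc)) l v := by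
    intro l v
    rw [e0, EdgePotentialColumnOrthogonal.contourSum_sub_apply, ← contourSum_dz]
  -- bounds: `𝒬 m` and `blockSum τ` are bounded
  have hQ : ∀ l v, |contourSum Lc m l v| ≤ (box (d + 1) Lc).card * (Lc * B) := fun l v => ResolventCompositionStepB.abs_contourSum_le hmB l v
  have hbs : ∀ v, |blockSum Lc (treeGaugeAt (toSite r) m Lc) v| ≤ (box (d + 1) Lc).card * ((((d + 1 : ℕ) : ℝ)) * Lc * B) := by
    intro v
    simp only [AffineAveraging.blockSum]
    refine (Finset.abs_sum_le_sum_abs _ _).trans ?_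
    rw [← nsmul_eq_mul, ← Finset.sum_const]
    exact Finset.sum_le_sum fun b _ => hτ _
  have hs1 := summable_sum_wΦ_sub_mul M hQ κ u
  have hs2 := summable_sum_wΦ_sub_mul M (g := fun l v => dz (blockSum Lc (treeGaugeAt (toSite r) m Lc)) l v)
    (B := 2 * ((box (d + 1) Lc).card * ((((d + 1 : ℕ) : ℝ)) * Lc * B))) (fun l v => KKTFluctuationEnergy.abs_dz_le hbs l v) κ u
  have e : ∀ v, (∑ l : Fin (d + 1), wΦ (N := M) κ l (u - v) * contourSum Lc (axProjAt (toSite r) Lc m) l v)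
      = (∑ l : Fin (d + 1), wΦ (N := M) κ l (u - v) * contourSum Lc m l v)
        - ∑ l : Fin (d + 1), wΦ (N := M) κ l (u - v) * dz (blockSum Lc (treeGaugeAt (toSite r) m Lc)) l v := by
    intro v
    rw [← Finset.sum_sub_distrib]
    exact Finset.sum_congr rfl fun l _ => by rw [e1]; ring
  rw [tsum_congr e, hs1.tsum_sub hs2, tsum_sum_wΦ_mul_dz_eq_zero M hbs κ u, sub_zero]

end Summit.QuantumFields.BalabanUV.Beta.GAN24.EdgePotentialContourClimb

end
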